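import Literature.Probability.Percolation.ArmSeparationScheme
import HarnessLib

/-!
# The multi-scale scheme of the arm-separation theorem on a finite range of scales

Topic: Probability / Percolation; family `crit-perc`. A brick for the discharge of
`Literature.Probability.Percolation.Nolin2008_twoArm_separation` (`ArmSeparation.lean`; Nolin 2008,
Thm. 11 [arXiv 0711.4948: Thm. 10]). `ArmSeparationScheme.lean` proves the real-variable summation
`le_mul_of_separationScheme` with hypotheses on ALL scales `K ≥ k`. When the scheme is read
inward (internal extremities, Nolin 2008, §4.4, p. 13), the scales are the inner radii of a finite
ladder `n = r_0 < r_1 < ⋯ < r_L ≤ N/2`, and the percolation inputs (surgery, landing, extension)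
are only available down to the smallest radius of the ladder. This file records the same scheme
with hypotheses on the finite range `k ≤ K < L` and the conclusion on `k + 1 ≤ K ≤ L`
(`le_mul_of_separationScheme_upto`); the proof is that of `le_mul_of_separationScheme` verbatim
(two base scales and a two-step induction), each use of a hypothesis staying inside the range.

## References

* P. Nolin, *Near-critical percolation in two dimensions*, Electron. J. Probab. 13 (2008), §4.4
  (proof of Thm. 11) [arXiv 0711.4948: Thm. 10, p. 12–13]. [Nolin2008]
* O. Schramm, J. Steif, *Quantitative noise sensitivity and exceptional times for percolation*,
  Ann. Math. 171 (2010), Appendix A, Lemma A.4. [SchrammSteif2010]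
-/

namespace Literature.Probability.Percolation

/-- **The multi-scale summation on a finite range of scales** (Nolin 2008, §4.4, proof of Thm. 11
[arXiv 0711.4948: Thm. 10]; Schramm–Steif 2010, Lemma A.4): for real sequences `f, g, h`, if
`f ≤ 1`, `0 ≤ h`, and for the scales `K` with `K + 1 ≤ L`: `f (K+1) ≤ f K` (`K ≥ k+1`),
`f (K+1) ≤ g (K+1) + ε f K` (`K ≥ k`), `g K ≤ C₁ h (K+1)` and `h K ≤ C₀ h (K+1)` (`K ≥ k+1`), and
`c ≤ h (k+1)` with `c > 0`, `C₀ ≥ 1`, `C₁, ε ≥ 0`, `ε C₀² ≤ 1/2`, `k + 1 ≤ L`, then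
`f K ≤ (2C₁ + 1/c) h K` for all `k+1 ≤ K ≤ L`. [cite: Nolin2008, §4.4 (proof of Thm. 11; arXiv 0711.4948: Thm. 10)] -/
theorem le_mul_of_separationScheme_upto {f g h : ℕ → ℝ} {k L : ℕ} {ε C₀ C₁ c : ℝ}
    (hε : 0 ≤ ε) (hC₀ : 1 ≤ C₀) (hC₁ : 0 ≤ C₁) (hc : 0 < c) (hsmall : ε * C₀ ^ 2 ≤ 1 / 2)
    (hf1 : ∀ K, f K ≤ 1) (hh0 : ∀ K, 0 ≤ h K) (hkL : k + 1 ≤ L)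
    (hmono : ∀ K, k + 1 ≤ K → K + 1 ≤ L → f (K + 1) ≤ f K)
    (hstep : ∀ K, k ≤ K → K + 1 ≤ L → f (K + 1) ≤ g (K + 1) + ε * f K)
    (hland : ∀ K, k + 1 ≤ K → K + 1 ≤ L → g K ≤ C₁ * h (K + 1))
    (hext : ∀ K, k + 1 ≤ K → K + 1 ≤ L → h K ≤ C₀ * h (K + 1))
    (hinit : c ≤ h (k + 1)) :
    ∀ K, k + 1 ≤ K → K ≤ L → f K ≤ (2 * C₁ + 1 / c) * h K := by
  set M : ℝ := 2 * C₁ + 1 / c with hM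
  have hc' : 0 < 1 / c := one_div_pos.2 hc
  have hM0 : 0 ≤ M := by positivity
  have hMc : 1 / c ≤ M := by rw [hM]; linarith
  have hC₀0 : 0 ≤ C₀ := le_trans zero_le_one hC₀
  have hεC₀ : ε * C₀ ≤ 1 / 2 := by
    have h1 : 0 ≤ ε * C₀ * (C₀ - 1) := mul_nonneg (mul_nonneg hε hC₀0) (by linarith)
    nlinarith [h1, hsmall]
  -- the first scale: `f ≤ 1 ≤ h (k+1) / c`
  have base1 : f (k + 1) ≤ M * h (k + 1) := by
    have h1 : (1 : ℝ) ≤ 1 / c * h (k + 1) := by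
      rw [one_div_mul_eq_div, le_div_iff₀ hc, one_mul]
      exact hinit
    calc f (k + 1) ≤ 1 := hf1 _
      _ ≤ 1 / c * h (k + 1) := h1
      _ ≤ M * h (k + 1) := mul_le_mul_of_nonneg_right hMc (hh0 _)
  -- the second scale
  have base2 : k + 2 ≤ L → f (k + 2) ≤ M * h (k + 2) := by
    intro hk2
    have s1 : f (k + 2) ≤ f (k + 1) := hmono (k + 1) le_rfl hk2
    have s2 : f (k + 1) ≤ g (k + 1) + ε * f k := hstep k le_rfl hkL
    have s3 : g (k + 1) ≤ C₁ * h (k + 2) := hland (k + 1) le_rfl hk2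
    have s4 : ε * f k ≤ ε := by nlinarith [hf1 k, hε]
    have hh2 : c ≤ C₀ * h (k + 2) := hinit.trans (hext (k + 1) le_rfl hk2)
    have s5 : ε ≤ 1 / (2 * c) * h (k + 2) := by
      rw [one_div_mul_eq_div, le_div_iff₀ (by positivity)]
      have e1 : ε * (2 * c) ≤ ε * (2 * (C₀ * h (k + 2))) :=
        mul_le_mul_of_nonneg_left (by linarith) hε
      have e2 : ε * (2 * (C₀ * h (k + 2))) = (2 * (ε * C₀)) * h (k + 2) := by ring
      have e3 : (2 * (ε * C₀)) * h (k + 2) ≤ 1 * h (k + 2) :=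
        mul_le_mul_of_nonneg_right (by linarith) (hh0 _)
      linarith
    have s6 : 1 / (2 * c) * h (k + 2) ≤ 1 / c * h (k + 2) :=
      mul_le_mul_of_nonneg_right (one_div_le_one_div_of_le hc (by linarith)) (hh0 _)
    have s7 : 0 ≤ C₁ * h (k + 2) := mul_nonneg hC₁ (hh0 _)
    have : f (k + 2) ≤ C₁ * h (k + 2) + 1 / c * h (k + 2) := by linarith
    calc f (k + 2) ≤ C₁ * h (k + 2) + 1 / c * h (k + 2) := this
      _ ≤ M * h (k + 2) := by rw [hM]; nlinarith [s7]
  -- the two-step induction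
  have step : ∀ K, k + 1 ≤ K → K + 2 ≤ L → f K ≤ M * h K → f (K + 2) ≤ M * h (K + 2) := by
    intro K hK hKL hfK
    have s1 : f (K + 2) ≤ f (K + 1) := hmono (K + 1) (Nat.le_succ_of_le hK) hKL
    have s2 : f (K + 1) ≤ g (K + 1) + ε * f K := hstep K ((Nat.le_succ _).trans hK) (by omega)
    have s3 : g (K + 1) ≤ C₁ * h (K + 2) := hland (K + 1) (Nat.le_succ_of_le hK) hKL
    have s4 : h K ≤ C₀ ^ 2 * h (K + 2) :=
      calc h K ≤ C₀ * h (K + 1) := hext K hK (by omega)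
        _ ≤ C₀ * (C₀ * h (K + 2)) :=
          mul_le_mul_of_nonneg_left (hext (K + 1) (Nat.le_succ_of_le hK) hKL) hC₀0
        _ = C₀ ^ 2 * h (K + 2) := by ring
    have s5 : ε * f K ≤ ε * (M * (C₀ ^ 2 * h (K + 2))) :=
      mul_le_mul_of_nonneg_left (hfK.trans (mul_le_mul_of_nonneg_left s4 hM0)) hε
    have s6 : ε * (M * (C₀ ^ 2 * h (K + 2))) = (ε * C₀ ^ 2) * (M * h (K + 2)) := by ring
    have s7 : (ε * C₀ ^ 2) * (M * h (K + 2)) ≤ 1 / 2 * (M * h (K + 2)) :=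
      mul_le_mul_of_nonneg_right hsmall (mul_nonneg hM0 (hh0 _))
    have s8 : C₁ * h (K + 2) ≤ 1 / 2 * (M * h (K + 2)) := by
      have e : 1 / 2 * (M * h (K + 2)) = C₁ * h (K + 2) + 1 / (2 * c) * h (K + 2) := by
        rw [hM]; field_simp
      rw [e]
      have : 0 ≤ 1 / (2 * c) * h (K + 2) := mul_nonneg (by positivity) (hh0 _)
      linarith
    linarith
  have pair : ∀ d, (k + 1 + d ≤ L → f (k + 1 + d) ≤ M * h (k + 1 + d)) ∧
      (k + 1 + d + 1 ≤ L → f (k + 1 + d + 1) ≤ M * h (k + 1 + d + 1)) := by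
    intro d
    induction d with
    | zero => exact ⟨fun _ => base1, fun h2 => base2 h2⟩
    | succ d ih =>
      refine ⟨fun hL => ih.2 (by omega), fun hL => ?_⟩
      have := step (k + 1 + d) (Nat.le_add_right _ _) (by omega) (ih.1 (by omega))
      simpa [Nat.add_assoc] using this
  intro K hK hKL
  obtain ⟨d, rfl⟩ : ∃ d, K = k + 1 + d := ⟨K - (k + 1), by omega⟩
  exact (pair d).1 hKL

end Literature.Probability.Percolation
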